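import Summits.CriticalPhenomena.PercolationContinuityZ3.Theorems.SahiConjectureProduct
import Summits.CriticalPhenomena.PercolationContinuityZ3.Theorems.SahiConjectureUniform
import Summits.CriticalPhenomena.PercolationContinuityZ3.Theorems.SahiLiebSahiContinuumProduct
import Summits.CriticalPhenomena.PercolationContinuityZ3.Theorems.SahiLiebSahiContinuumDensity
import Summits.CriticalPhenomena.PercolationContinuityZ3.Theorems.SahiLiebSahiContinuumEvents
import Summits.CriticalPhenomena.PercolationContinuityZ3.Theorems.SahiBoxTP2Positivity
import Summits.CriticalPhenomena.PercolationContinuityZ3.Theorems.SahiBoxTP2HilbertPositivity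
import Summits.CriticalPhenomena.PercolationContinuityZ3.Theorems.SahiBoxTP2BooleanSpinsIff
import Mathlib.Data.List.TFAE

/-!
# Sahi's conjecture `C_n`: the equivalent forms proved in the tree, as one `TFAE`

Support file of the Sahi cell (`prim-sahi`, typer seat, generation 16; `--supports stmt-CriticalPhenomena-4575`).
Theorems only (no definitions, no named facts, no sorries).  One citable statement (`sahiConjecture_tfae`) collecting
the equivalent forms of the typed obligation `SahiConjecture n` (Sahi 2008 Conj. 5 / Lieb–Sahi 2022 Conj. 1.1: every
FKG probability weight on a finite distributive lattice is Sahi-positive of order `n`) established across the cell's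
files — each item below is, on its own, an existing `iff` theorem; nothing new is proved here except the packaging:

 0. `SahiConjecture n` (all finite distributive lattices, all FKG probability weights);
 1. all finite PRODUCT measures `⊗ Ber(p_i)` on Boolean cubes (Kahn's form; `sahiConjecture_iff_forall_bernoulliWeight`,
    van den Berg's "FKG measures are FUI");
 2. the UNIFORM measures on the cubes `{0,1}^M` (`sahiConjecture_iff_forall_uniformWeight_fin`);
 3. all FKG weights on lattices of SETS `2^X` (`sahiConjecture_iff_forall_set`);
 4. `∀ d, LiebSahiContinuum d n`: LEBESGUE measure on `Q_d = [0,1]^d`, positive decreasing families (Lieb–Sahi's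
    continuous formulation; `sahiConjecture_iff_forall_liebSahiContinuum`);
 5. `∀ d`, all PRODUCT probability measures on `Q_d`, measurable nonnegative decreasing families
    (`liebSahiContinuum_iff_pi`);
 6. `∀ d`, all probability measures on `Q_d` with a bounded measurable LOG-SUPERMODULAR DENSITY
    (`liebSahiContinuum_iff_withDensity`);
 7. `∀ d`, indicator families of measurable UP-SETS under Lebesgue measure on `Q_d` (`liebSahiContinuum_iff_upperEvents`);
 8. `∀ d`, all BOX-TP₂ probability measures on `Q_d` (density-free MTP₂; `liebSahiContinuum_iff_isBoxTP2`);
 9. all box-TP₂ probability measures on the HILBERT CUBE `[0,1]^ℕ` (`sahiConjecture_iff_forall_isBoxTP2_hilbert`);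
10. all box-TP₂ probability measures on `{0,1}^ℕ` (`sahiConjecture_iff_forall_isBoxTP2_spins`);
11. all probability measures on `{0,1}^ℕ` with FKG-lattice finite-dimensional marginals
    (`sahiConjecture_iff_forall_fkg_marginals`).

Appended (generation 16): `kahnConjecture_tfae` — the order-3 package (Kahn's Conjecture 5, `SahiConjecture 3`,
product measures, the uniform-cube counting inequality, `∀ d, LiebSahiContinuum d 3`); `liebSahiContinuum_tfae d n`
— the dimension-`d` package (11 forms of the Lieb–Sahi continuous case).

No sorries, no new axioms.
-/

noncomputable section

namespace Summit.CriticalPhenomena.PercolationContinuityZ3.Theorems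

open MeasureTheory Set Literature.Combinatorics.Sahi2008 SahiBoxTP2
open scoped ENNReal NNReal unitInterval

/-- **The equivalent forms of Sahi's conjecture `C_n` proved in the tree.** [this work; cite: Sahi2008, Conj. 5
(p. 212); LiebSahi2021, Conj. 1.1] -/
theorem sahiConjecture_tfae (n : ℕ) :
    List.TFAE
      [ SahiConjecture n,
        ∀ (ι : Type) [Fintype ι] (p : ι → unitInterval), SahiPositive (bernoulliWeight p) n,
        ∀ M : ℕ, SahiPositive (uniformWeight (Fin M)) n,
        ∀ (X : Type) [Fintype X] (μ : Set X → ℝ), IsFKGMeasure μ → SahiPositive μ n,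
        ∀ d, LiebSahiContinuum d n,
        ∀ (d : ℕ) (μ : Fin d → Measure I), (∀ j, IsProbabilityMeasure (μ j)) →
          ∀ f : Fin n → (Fin d → I) → ℝ, (∀ i, Measurable (f i)) → (∀ i x, 0 ≤ f i x) →
            (∀ i, Antitone (f i)) → 0 ≤ msahiE (Measure.pi μ) n f,
        ∀ (d : ℕ) (ρ : (Fin d → I) → ℝ≥0∞), Measurable ρ → (∃ R : ℝ≥0, ∀ x, ρ x ≤ R) →
          (∀ x y, ρ x * ρ y ≤ ρ (x ⊔ y) * ρ (x ⊓ y)) → IsProbabilityMeasure (volume.withDensity ρ) →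
            MSahiPositive (volume.withDensity ρ) n,
        ∀ (d : ℕ) (U : Fin n → Set (Fin d → I)), (∀ k, IsUpperSet (U k)) → (∀ k, MeasurableSet (U k)) →
          0 ≤ msahiE (volume : Measure (Fin d → I)) n (fun k => (U k).indicator 1),
        ∀ (d : ℕ) (μ : Measure (Fin d → I)), IsProbabilityMeasure μ → IsBoxTP2 μ →
          ∀ f : Fin n → (Fin d → I) → ℝ, (∀ i, Measurable (f i)) → (∀ i x, 0 ≤ f i x) → (∀ i, Monotone (f i)) →
            0 ≤ msahiE μ n f,
        ∀ μ : Measure (ℕ → I), IsProbabilityMeasure μ → IsBoxTP2 μ →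
          ∀ f : Fin n → (ℕ → I) → ℝ, (∀ i, Measurable (f i)) → (∀ i u, 0 ≤ f i u) → (∀ i, Monotone (f i)) →
            0 ≤ msahiE μ n f,
        ∀ μ : Measure (ℕ → Bool), IsProbabilityMeasure μ → IsBoxTP2 μ →
          ∀ f : Fin n → (ℕ → Bool) → ℝ, (∀ i, Measurable (f i)) → (∀ i u, 0 ≤ f i u) → (∀ i, Monotone (f i)) →
            0 ≤ msahiE μ n f,
        ∀ μ : Measure (ℕ → Bool), IsProbabilityMeasure μ →
          (∀ (d : ℕ) (x y : Fin d → Bool),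
            μ.real {u | finRestrict d u = x} * μ.real {u | finRestrict d u = y} ≤
              μ.real {u | finRestrict d u = x ⊓ y} * μ.real {u | finRestrict d u = x ⊔ y}) →
          ∀ f : Fin n → (ℕ → Bool) → ℝ, (∀ i, Measurable (f i)) → (∀ i u, 0 ≤ f i u) → (∀ i, Monotone (f i)) →
            0 ≤ msahiE μ n f ] := by
  tfae_have 1 ↔ 2 := sahiConjecture_iff_forall_bernoulliWeight n
  tfae_have 1 ↔ 3 := sahiConjecture_iff_forall_uniformWeight_fin n
  tfae_have 1 ↔ 4 := sahiConjecture_iff_forall_set n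
  tfae_have 1 ↔ 5 := sahiConjecture_iff_forall_liebSahiContinuum n
  tfae_have 5 ↔ 6 := forall_congr' fun d => liebSahiContinuum_iff_pi
  tfae_have 5 ↔ 7 := forall_congr' fun d => SahiCubeDensity.liebSahiContinuum_iff_withDensity
  tfae_have 5 ↔ 8 := forall_congr' fun d => liebSahiContinuum_iff_upperEvents d n
  tfae_have 5 ↔ 9 := forall_congr' fun d => liebSahiContinuum_iff_isBoxTP2
  tfae_have 1 ↔ 10 := sahiConjecture_iff_forall_isBoxTP2_hilbert n
  tfae_have 1 ↔ 11 := sahiConjecture_iff_forall_isBoxTP2_spins n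
  tfae_have 1 ↔ 12 := sahiConjecture_iff_forall_fkg_marginals n
  tfae_finish

/-- **All orders at once**: Sahi's Conjecture 5 for every `n` (⟺ Conjecture 4, the generating-function form
`SahiGFConjecture`) ⟺ the Lieb–Sahi continuous conjecture in every dimension and order. [this work] -/
theorem forall_sahiConjecture_tfae :
    List.TFAE [ ∀ n, SahiConjecture n, SahiGFConjecture, ∀ d n, LiebSahiContinuum d n,
      ∀ (ι : Type) [Fintype ι] (p : ι → unitInterval) (n : ℕ), SahiPositive (bernoulliWeight p) n ] := by
  tfae_have 2 ↔ 1 := sahiGFConjecture_iff_forall_sahiConjecture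
  tfae_have 1 ↔ 3 := forall_sahiConjecture_iff_forall_liebSahiContinuum
  tfae_have 1 ↔ 4 := by
    rw [forall_sahiConjecture_iff_forall_bernoulliWeight]
    exact ⟨fun h ι _ p n => h n ι p, fun h n ι _ p => h ι p n⟩
  tfae_finish

/-- **The order-3 case (Kahn's Conjecture 5)**: `KahnConjecture` (product measures, three increasing events) ⟺
`SahiConjecture 3` ⟺ order-3 Sahi positivity of all finite product measures ⟺ the uniform-cube COUNTING inequality
`2^M(|A||B∩C| + |B||A∩C| + |C||A∩B|) ≤ 2·4^M|A∩B∩C| + |A||B||C|` for up-sets of `{0,1}^M` ⟺ the Lieb–Sahi continuous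
case of order `3` in every dimension. [this work; cite: Kahn2022, Conj. 5 (arXiv p. 3); Sahi2008, Conj. 5 (p. 212)] -/
theorem kahnConjecture_tfae :
    List.TFAE
      [ KahnConjecture,
        SahiConjecture 3,
        ∀ (ι : Type) [Fintype ι] (p : ι → unitInterval), SahiPositive (bernoulliWeight p) 3,
        ∀ (M : ℕ) (A B C : Finset (Fin M → Bool)), IsUpperSet (A : Set (Fin M → Bool)) →
          IsUpperSet (B : Set (Fin M → Bool)) → IsUpperSet (C : Set (Fin M → Bool)) →
          2 ^ M * (A.card * (B ∩ C).card + B.card * (A ∩ C).card + C.card * (A ∩ B).card) ≤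
            2 * 2 ^ M * 2 ^ M * (A ∩ B ∩ C).card + A.card * B.card * C.card,
        ∀ d, LiebSahiContinuum d 3 ] := by
  tfae_have 2 ↔ 1 := sahiConjecture_three_iff_kahnConjecture
  tfae_have 2 ↔ 3 := sahiConjecture_iff_forall_bernoulliWeight 3
  tfae_have 1 ↔ 4 := kahnConjecture_iff_counting
  tfae_have 1 ↔ 5 := kahnConjecture_iff_forall_liebSahiContinuum_three
  tfae_finish

/-- **The Lieb–Sahi continuous case at fixed dimension `d` and order `n`: the equivalent forms in the tree** —
Lebesgue measure on `Q_d` with positive decreasing families (`LiebSahiContinuum d n`) ⟺ `MSahiPositive volume n` ⟺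
the UNIFORM weights on the grids `[M]^d` ⟺ all PRODUCT weights on the grids `[K+1]^d` ⟺ all FKG weights on the grids
`[b+1]^d` ⟺ all product probability measures on `Q_d` ⟺ all bounded measurable log-supermodular densities on `Q_d`
⟺ indicator families of measurable up-sets ⟺ of measurable down-sets ⟺ all box-TP₂ probability measures on `Q_d` ⟺
Lebesgue measure on the unit cube of `ℝ^d` (antitone families). [this work; cite: LiebSahi2021, Conj. 1.1 and §3] -/
theorem liebSahiContinuum_tfae (d n : ℕ) :
    List.TFAE
      [ LiebSahiContinuum d n,
        MSahiPositive (volume : Measure (Fin d → I)) n,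
        ∀ M : ℕ, 0 < M → SahiPositive (fun _ : Fin d → Fin M => (1 : ℝ) / (M : ℝ) ^ d) n,
        ∀ (K : ℕ) (g : Fin d → Fin (K + 1) → ℝ), (∀ i u, 0 ≤ g i u) → (∀ i, ∑ u, g i u = 1) →
          SahiPositive (fun ω : Fin d → Fin (K + 1) => ∏ i, g i (ω i)) n,
        ∀ (b : ℕ) (μ : (Fin d → Fin (b + 1)) → ℝ), IsFKGMeasure μ → SahiPositive μ n,
        ∀ (μ : Fin d → Measure I), (∀ j, IsProbabilityMeasure (μ j)) →
          ∀ f : Fin n → (Fin d → I) → ℝ, (∀ i, Measurable (f i)) → (∀ i x, 0 ≤ f i x) →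
            (∀ i, Antitone (f i)) → 0 ≤ msahiE (Measure.pi μ) n f,
        ∀ (ρ : (Fin d → I) → ℝ≥0∞), Measurable ρ → (∃ R : ℝ≥0, ∀ x, ρ x ≤ R) →
          (∀ x y, ρ x * ρ y ≤ ρ (x ⊔ y) * ρ (x ⊓ y)) → IsProbabilityMeasure (volume.withDensity ρ) →
            MSahiPositive (volume.withDensity ρ) n,
        ∀ U : Fin n → Set (Fin d → I), (∀ k, IsUpperSet (U k)) → (∀ k, MeasurableSet (U k)) →
          0 ≤ msahiE (volume : Measure (Fin d → I)) n (fun k => (U k).indicator 1),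
        ∀ D : Fin n → Set (Fin d → I), (∀ k, IsLowerSet (D k)) → (∀ k, MeasurableSet (D k)) →
          0 ≤ msahiE (volume : Measure (Fin d → I)) n (fun k => (D k).indicator 1),
        ∀ μ : Measure (Fin d → I), IsProbabilityMeasure μ → IsBoxTP2 μ →
          ∀ f : Fin n → (Fin d → I) → ℝ, (∀ i, Measurable (f i)) → (∀ i x, 0 ≤ f i x) → (∀ i, Monotone (f i)) →
            0 ≤ msahiE μ n f,
        ∀ f : Fin n → (Fin d → ℝ) → ℝ, (∀ i, ∀ y ∈ unitCube d, 0 ≤ f i y) → (∀ i, AntitoneOn (f i) (unitCube d)) →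
          0 ≤ msahiE ((volume : Measure (Fin d → ℝ)).restrict (unitCube d)) n f ] := by
  tfae_have 1 ↔ 2 := liebSahiContinuum_iff_mSahiPositive
  tfae_have 1 ↔ 3 := liebSahiContinuum_iff_uniformGrid d n
  tfae_have 1 ↔ 4 := liebSahiContinuum_iff_prodGrid d n
  tfae_have 1 ↔ 5 := liebSahiContinuum_iff_fkgGrid d n
  tfae_have 1 ↔ 6 := liebSahiContinuum_iff_pi
  tfae_have 1 ↔ 7 := SahiCubeDensity.liebSahiContinuum_iff_withDensity
  tfae_have 1 ↔ 8 := liebSahiContinuum_iff_upperEvents d n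
  tfae_have 1 ↔ 9 := liebSahiContinuum_iff_lowerEvents d n
  tfae_have 1 ↔ 10 := liebSahiContinuum_iff_isBoxTP2
  tfae_have 1 ↔ 11 := liebSahiContinuum_iff_real d n
  tfae_finish

end Summit.CriticalPhenomena.PercolationContinuityZ3.Theorems
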